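import Summits.KontsevichZagierPeriods.KontsevichZagierPeriods.Theorems.OctahedralSymmetryZhaoRelationInKZStuffleAux
import Summits.KontsevichZagierPeriods.KontsevichZagierPeriods.Theorems.OctahedralSymmetryZhaoRelationInKZCommon

/-!
# `ZhaoRelationInKZ` (stmt-KontsevichZagierPeriods-9433), line `Sketch`: stub `stub_stuffle`

The series-side (stuffle) half of the finite double shuffle block (1)×(1,1) at level 4 inside the
Kontsevich–Zagier calculus: for poles `p = i^x ≠ 1`, `q = i^y ≠ 1`, `qr = i^{y+z}`, the real and the
imaginary parts of the complex product `I(p)·I(q, qr)` — the Fubini products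
`[R_p × R_V] − [J_p × J_V]` and `[R_p × J_V] + [J_p × R_V]` on `(0,1) × Δ₂` — are congruent modulo
`KZ.relations` to the same parts of `I(p,pq,pqr) + I(q,pq,pqr) + I(q,qr,pqr) − I(0,pq,pqr) − I(q,0,pqr)`
[Zhao 2010, Def. 2.4: `Li₁(x)Li_{1,1}(y,z) = Li_{1,1,1}(x,y,z) + Li_{1,1,1}(y,x,z) + Li_{1,1,1}(y,z,x)
+ Li_{2,1}(xy,z) + Li_{1,2}(y,xz)` read through `Li = (-1)^ℓ I`].

Proof: the six-term cube chain `stuffle_chain` of the auxiliary file, applied to the real-linear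
functionals `Complex.reLm` and `Complex.imLm`; the product representation of the statement and the
representation fed to the chain differ by one integrand-additivity move
(`Re(ab) = Re a Re b − Im a Im b`, `Im(ab) = Re a Im b + Im a Re b`).

References: J. Zhao, Doc. Math. 15 (2010), §2; M. Kontsevich, D. Zagier, *Periods* (2001), §1.2, §4.1.
-/

noncomputable section

open Set MeasureTheory Complex
open Literature.NumberTheory.Transcendental Literature.NumberTheory.Transcendental.KZ

namespace Summit.KontsevichZagierPeriods.OctahedralSymmetry.ZhaoRelationInKZ

/-! ## Unfolding the canonical representations -/

/-- `Fin.castSucc m ≠ 4` for `m : Fin 4`. [folklore] -/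
theorem stuffle_castSucc_ne_four (m : Fin 4) : Fin.castSucc m ≠ (4 : Fin 5) := fun h => by
  have := congrArg Fin.val h
  simp at this
  omega

/-- `Fin.castSucc m = 0 ↔ m = 0`. [folklore] -/
theorem stuffle_castSucc_ne_zero {m : Fin 4} (hm : m ≠ 0) : Fin.castSucc m ≠ (0 : Fin 5) := fun h =>
  hm (Fin.castSucc_injective _ (by simpa using h))

/-! ## The product representation fed to the chain -/

/-- **The real part of a product of a letter and a two-word is the product representation of the
statement up to one integrand-additivity move.** There is a representation `P` on `(0,1) × Δ₂`
with integrand `Re(f_a(t₀) · f_{v₀}(t₁) f_{v₁}(t₂))` and `[P] − [R_a × R_V] + [J_a × J_V] ∈ relations`.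
[cite: KontsevichZagier2001, §4.1] -/
theorem exists_prodRep_re (a v₀ v₁ : Fin 5) (ha : LevelFour.IsConvergent [a])
    (hv : LevelFour.IsConvergent [v₀, v₁]) :
    ∃ P : IntegralRep 3, P.domain = {t | (0 < t 0 ∧ t 0 < 1) ∧ 1 > t 1 ∧ t 1 > t 2 ∧ t 2 > 0} ∧
      (∀ t ∈ P.domain, P.integrand t = Complex.reLm (levelFourFactor a (t 0) *
        (levelFourFactor v₀ (t 1) * levelFourFactor v₁ (t 2)))) ∧
      of P - of ((levelFourRepRe [a] (integrableOn_levelFourIntegrandC ha)).prod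
          (levelFourRepRe [v₀, v₁] (integrableOn_levelFourIntegrandC hv)))
        + of ((levelFourRepIm [a] (integrableOn_levelFourIntegrandC ha)).prod
          (levelFourRepIm [v₀, v₁] (integrableOn_levelFourIntegrandC hv))) ∈ relations := by
  set RR := (levelFourRepRe [a] (integrableOn_levelFourIntegrandC ha)).prod
    (levelFourRepRe [v₀, v₁] (integrableOn_levelFourIntegrandC hv)) with hRR
  set JJ := (levelFourRepIm [a] (integrableOn_levelFourIntegrandC ha)).prod
    (levelFourRepIm [v₀, v₁] (integrableOn_levelFourIntegrandC hv)) with hJJ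
  have hdJ : JJ.domain = RR.domain := rfl
  let P : IntegralRep 3 :=
    { domain := RR.domain
      integrand := fun t => RR.integrand t - JJ.integrand t
      isSemialgebraic_domain := RR.isSemialgebraic_domain
      isSemialgebraicFunOn_integrand := IsSemialgebraicFunOn.sub_holds
        RR.isSemialgebraicFunOn_integrand (hdJ ▸ JJ.isSemialgebraicFunOn_integrand)
      integrableOn := RR.integrableOn.sub (hdJ ▸ JJ.integrableOn) }
  refine ⟨P, ?_, fun t _ => ?_, ?_⟩
  · show RR.domain = _
    rw [hRR, IntegralRep.prod_domain]
    exact prodDomain_one_two _ _ rfl rfl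
  · show RR.integrand t - JJ.integrand t = _
    have h1 : ∀ (m : Fin 5) (s : Fin 1 → ℝ), levelFourIntegrandC [m] s = levelFourFactor m (s 0) :=
      fun m s => by simp [levelFourIntegrandC, levelFourProd]
    have h2 : ∀ (m m' : Fin 5) (s : Fin 2 → ℝ),
        levelFourIntegrandC [m, m'] s = levelFourFactor m (s 0) * levelFourFactor m' (s 1) :=
      fun m m' s => by simp [levelFourIntegrandC, levelFourProd, Fin.prod_univ_two]
    rw [hRR, hJJ, IntegralRep.prod_integrand_eq, IntegralRep.prod_integrand_eq,
      IntegralRep.prodFun_apply, IntegralRep.prodFun_apply]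
    simp only [levelFourRepRe_integrand, levelFourRepIm_integrand, levelFourIntegrandRe,
      levelFourIntegrandIm, h1, h2, Complex.reLm_coe, Complex.mul_re]
    rfl
  · have h1 : of P - of RR - ∑ i : Fin 1, of ((![JJ.neg] : Fin 1 → IntegralRep 3) i) ∈ relations :=
      of_sub_of_sub_sum_mem_relations 1 P RR ![JJ.neg] rfl (fun i => by fin_cases i; rfl)
        fun t _ => by simp [P, sub_eq_add_neg]
    have h2 : of JJ + of JJ.neg ∈ relations :=
      of_add_of_mem_relations_of_eqOn_neg rfl fun _ _ => rfl
    simp only [Finset.univ_unique, Fin.default_eq_zero, Fin.isValue, Matrix.cons_val_fin_one,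
      Finset.sum_singleton] at h1
    have : of P - of RR + of JJ = (of P - of RR - of JJ.neg) + (of JJ + of JJ.neg) := by abel
    rw [this]
    exact relations.add_mem h1 h2

/-- **The imaginary part of a product of a letter and a two-word.** There is a representation `P`
on `(0,1) × Δ₂` with integrand `Im(f_a(t₀) · f_{v₀}(t₁) f_{v₁}(t₂))` and
`[P] − [R_a × J_V] − [J_a × R_V] ∈ relations`. [cite: KontsevichZagier2001, §4.1] -/
theorem exists_prodRep_im (a v₀ v₁ : Fin 5) (ha : LevelFour.IsConvergent [a])
    (hv : LevelFour.IsConvergent [v₀, v₁]) :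
    ∃ P : IntegralRep 3, P.domain = {t | (0 < t 0 ∧ t 0 < 1) ∧ 1 > t 1 ∧ t 1 > t 2 ∧ t 2 > 0} ∧
      (∀ t ∈ P.domain, P.integrand t = Complex.imLm (levelFourFactor a (t 0) *
        (levelFourFactor v₀ (t 1) * levelFourFactor v₁ (t 2)))) ∧
      of P - of ((levelFourRepRe [a] (integrableOn_levelFourIntegrandC ha)).prod
          (levelFourRepIm [v₀, v₁] (integrableOn_levelFourIntegrandC hv)))
        - of ((levelFourRepIm [a] (integrableOn_levelFourIntegrandC ha)).prod
          (levelFourRepRe [v₀, v₁] (integrableOn_levelFourIntegrandC hv))) ∈ relations := by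
  set RJ := (levelFourRepRe [a] (integrableOn_levelFourIntegrandC ha)).prod
    (levelFourRepIm [v₀, v₁] (integrableOn_levelFourIntegrandC hv)) with hRJ
  set JR := (levelFourRepIm [a] (integrableOn_levelFourIntegrandC ha)).prod
    (levelFourRepRe [v₀, v₁] (integrableOn_levelFourIntegrandC hv)) with hJR
  have hdJ : JR.domain = RJ.domain := rfl
  let P : IntegralRep 3 :=
    { domain := RJ.domain
      integrand := fun t => RJ.integrand t + JR.integrand t
      isSemialgebraic_domain := RJ.isSemialgebraic_domain
      isSemialgebraicFunOn_integrand := IsSemialgebraicFunOn.add_holds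
        RJ.isSemialgebraicFunOn_integrand (hdJ ▸ JR.isSemialgebraicFunOn_integrand)
      integrableOn := RJ.integrableOn.add (hdJ ▸ JR.integrableOn) }
  refine ⟨P, ?_, fun t _ => ?_, ?_⟩
  · show RJ.domain = _
    rw [hRJ, IntegralRep.prod_domain]
    exact prodDomain_one_two _ _ rfl rfl
  · show RJ.integrand t + JR.integrand t = _
    have h1 : ∀ (m : Fin 5) (s : Fin 1 → ℝ), levelFourIntegrandC [m] s = levelFourFactor m (s 0) :=
      fun m s => by simp [levelFourIntegrandC, levelFourProd]
    have h2 : ∀ (m m' : Fin 5) (s : Fin 2 → ℝ),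
        levelFourIntegrandC [m, m'] s = levelFourFactor m (s 0) * levelFourFactor m' (s 1) :=
      fun m m' s => by simp [levelFourIntegrandC, levelFourProd, Fin.prod_univ_two]
    rw [hRJ, hJR, IntegralRep.prod_integrand_eq, IntegralRep.prod_integrand_eq,
      IntegralRep.prodFun_apply, IntegralRep.prodFun_apply]
    simp only [levelFourRepRe_integrand, levelFourRepIm_integrand, levelFourIntegrandRe,
      levelFourIntegrandIm, h1, h2, Complex.imLm_coe, Complex.mul_im]
    rfl
  · have h1 : of P - of RJ - ∑ i : Fin 1, of ((![JR] : Fin 1 → IntegralRep 3) i) ∈ relations :=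
      of_sub_of_sub_sum_mem_relations 1 P RJ ![JR] rfl (fun i => by fin_cases i; rfl)
        fun t _ => by simp [P]
    simpa using h1

/-! ## The stub -/

/-- **Stub `stub_stuffle`** (engine fds, the stuffle half of block (1)×(1,1)): for poles
`p = i^x ≠ 1`, `q = i^y ≠ 1`, `r = i^{y+z}` the complex product `I(p)·I(q, r)` is congruent to
`I(p,pq,pr) + I(q,pq,pr) + I(q,r,pr) − I(0,pq,pr) − I(q,0,pr)` (real parts, and imaginary parts,
over class functions `Zr`, `Zi`): the six-term cube chain `stuffle_chain` (two monomial-chart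
transports, two coordinate permutations, one pointwise partial fraction) for `re` and for `im`,
preceded by one integrand-additivity move relating the product of the statement to the chain's
product representation. [cite: Zhao2010, §2 Def. 2.4] -/
theorem stub_stuffle (Zr Zi : List (Fin 5) → FormalRep)
    (hZr : ∀ (W : List (Fin 5)) (h : LevelFour.IsConvergent W),
      Zr W = of (levelFourRepRe W (integrableOn_levelFourIntegrandC h)))
    (hZi : ∀ (W : List (Fin 5)) (h : LevelFour.IsConvergent W),
      Zi W = of (levelFourRepIm W (integrableOn_levelFourIntegrandC h)))
    (x y z : Fin 4) (hx : x ≠ 0) (hy : y ≠ 0)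
    (ha : LevelFour.IsConvergent [Fin.castSucc x])
    (hv : LevelFour.IsConvergent [Fin.castSucc y, Fin.castSucc (y + z)]) :
    of ((levelFourRepRe [Fin.castSucc x] (integrableOn_levelFourIntegrandC ha)).prod
          (levelFourRepRe [Fin.castSucc y, Fin.castSucc (y + z)] (integrableOn_levelFourIntegrandC hv)))
      - of ((levelFourRepIm [Fin.castSucc x] (integrableOn_levelFourIntegrandC ha)).prod
          (levelFourRepIm [Fin.castSucc y, Fin.castSucc (y + z)] (integrableOn_levelFourIntegrandC hv)))
      - (Zr [Fin.castSucc x, Fin.castSucc (x + y), Fin.castSucc (x + y + z)]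
        + Zr [Fin.castSucc y, Fin.castSucc (x + y), Fin.castSucc (x + y + z)]
        + Zr [Fin.castSucc y, Fin.castSucc (y + z), Fin.castSucc (x + y + z)]
        - Zr [4, Fin.castSucc (x + y), Fin.castSucc (x + y + z)]
        - Zr [Fin.castSucc y, 4, Fin.castSucc (x + y + z)]) ∈ relations ∧
    of ((levelFourRepRe [Fin.castSucc x] (integrableOn_levelFourIntegrandC ha)).prod
          (levelFourRepIm [Fin.castSucc y, Fin.castSucc (y + z)] (integrableOn_levelFourIntegrandC hv)))
      + of ((levelFourRepIm [Fin.castSucc x] (integrableOn_levelFourIntegrandC ha)).prod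
          (levelFourRepRe [Fin.castSucc y, Fin.castSucc (y + z)] (integrableOn_levelFourIntegrandC hv)))
      - (Zi [Fin.castSucc x, Fin.castSucc (x + y), Fin.castSucc (x + y + z)]
        + Zi [Fin.castSucc y, Fin.castSucc (x + y), Fin.castSucc (x + y + z)]
        + Zi [Fin.castSucc y, Fin.castSucc (y + z), Fin.castSucc (x + y + z)]
        - Zi [4, Fin.castSucc (x + y), Fin.castSucc (x + y + z)]
        - Zi [Fin.castSucc y, 4, Fin.castSucc (x + y + z)]) ∈ relations := by
  -- convergence of the five words
  have hcx : Fin.castSucc x ≠ 0 := stuffle_castSucc_ne_zero hx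
  have hcy : Fin.castSucc y ≠ 0 := stuffle_castSucc_ne_zero hy
  have c₁ : LevelFour.IsConvergent [Fin.castSucc x, Fin.castSucc (x + y), Fin.castSucc (x + y + z)] :=
    ⟨by simpa using hcx, by simpa using stuffle_castSucc_ne_four _⟩
  have c₂ : LevelFour.IsConvergent [Fin.castSucc y, Fin.castSucc (x + y), Fin.castSucc (x + y + z)] :=
    ⟨by simpa using hcy, by simpa using stuffle_castSucc_ne_four _⟩
  have c₃ : LevelFour.IsConvergent [Fin.castSucc y, Fin.castSucc (y + z), Fin.castSucc (x + y + z)] :=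
    ⟨by simpa using hcy, by simpa using stuffle_castSucc_ne_four _⟩
  have c₄ : LevelFour.IsConvergent [4, Fin.castSucc (x + y), Fin.castSucc (x + y + z)] :=
    ⟨by simp, by simpa using stuffle_castSucc_ne_four _⟩
  have c₅ : LevelFour.IsConvergent [Fin.castSucc y, 4, Fin.castSucc (x + y + z)] :=
    ⟨by simpa using hcy, by simpa using stuffle_castSucc_ne_four _⟩
  constructor
  · -- real parts
    obtain ⟨P, hPd, hPi, hPe⟩ := exists_prodRep_re (Fin.castSucc x) (Fin.castSucc y)
      (Fin.castSucc (y + z)) ha hv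
    have key := stuffle_chain Complex.reLm x y z P hPd hPi
      (levelFourRepRe _ (integrableOn_levelFourIntegrandC c₁))
      (levelFourRepRe _ (integrableOn_levelFourIntegrandC c₂))
      (levelFourRepRe _ (integrableOn_levelFourIntegrandC c₃))
      (levelFourRepRe _ (integrableOn_levelFourIntegrandC c₄))
      (levelFourRepRe _ (integrableOn_levelFourIntegrandC c₅))
      LevelFourStuffleInKZ.setOf_ordered_three_eq_openOrderedSimplex.symm LevelFourStuffleInKZ.setOf_ordered_three_eq_openOrderedSimplex.symm LevelFourStuffleInKZ.setOf_ordered_three_eq_openOrderedSimplex.symm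
      LevelFourStuffleInKZ.setOf_ordered_three_eq_openOrderedSimplex.symm LevelFourStuffleInKZ.setOf_ordered_three_eq_openOrderedSimplex.symm
      (fun t _ => by simp [levelFourIntegrandRe, levelFourIntegrandC, levelFourProd, Fin.prod_univ_three])
      (fun t _ => by simp [levelFourIntegrandRe, levelFourIntegrandC, levelFourProd, Fin.prod_univ_three])
      (fun t _ => by simp [levelFourIntegrandRe, levelFourIntegrandC, levelFourProd, Fin.prod_univ_three])
      (fun t _ => by simp [levelFourIntegrandRe, levelFourIntegrandC, levelFourProd, Fin.prod_univ_three])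
      (fun t _ => by simp [levelFourIntegrandRe, levelFourIntegrandC, levelFourProd, Fin.prod_univ_three])
    rw [hZr _ c₁, hZr _ c₂, hZr _ c₃, hZr _ c₄, hZr _ c₅]
    convert relations.sub_mem key hPe using 1
    abel
  · -- imaginary parts
    obtain ⟨P, hPd, hPi, hPe⟩ := exists_prodRep_im (Fin.castSucc x) (Fin.castSucc y)
      (Fin.castSucc (y + z)) ha hv
    have key := stuffle_chain Complex.imLm x y z P hPd hPi
      (levelFourRepIm _ (integrableOn_levelFourIntegrandC c₁))
      (levelFourRepIm _ (integrableOn_levelFourIntegrandC c₂))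
      (levelFourRepIm _ (integrableOn_levelFourIntegrandC c₃))
      (levelFourRepIm _ (integrableOn_levelFourIntegrandC c₄))
      (levelFourRepIm _ (integrableOn_levelFourIntegrandC c₅))
      LevelFourStuffleInKZ.setOf_ordered_three_eq_openOrderedSimplex.symm LevelFourStuffleInKZ.setOf_ordered_three_eq_openOrderedSimplex.symm LevelFourStuffleInKZ.setOf_ordered_three_eq_openOrderedSimplex.symm
      LevelFourStuffleInKZ.setOf_ordered_three_eq_openOrderedSimplex.symm LevelFourStuffleInKZ.setOf_ordered_three_eq_openOrderedSimplex.symm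
      (fun t _ => by simp [levelFourIntegrandIm, levelFourIntegrandC, levelFourProd, Fin.prod_univ_three])
      (fun t _ => by simp [levelFourIntegrandIm, levelFourIntegrandC, levelFourProd, Fin.prod_univ_three])
      (fun t _ => by simp [levelFourIntegrandIm, levelFourIntegrandC, levelFourProd, Fin.prod_univ_three])
      (fun t _ => by simp [levelFourIntegrandIm, levelFourIntegrandC, levelFourProd, Fin.prod_univ_three])
      (fun t _ => by simp [levelFourIntegrandIm, levelFourIntegrandC, levelFourProd, Fin.prod_univ_three])
    rw [hZi _ c₁, hZi _ c₂, hZi _ c₃, hZi _ c₄, hZi _ c₅]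
    convert relations.sub_mem key hPe using 1
    abel

end Summit.KontsevichZagierPeriods.OctahedralSymmetry.ZhaoRelationInKZ

end
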